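import Summits.CriticalPhenomena.PercolationContinuityZ3.Theorems.Transplant.FKConnectivityAllQForestAdjacentFan
import HarnessLib

/-!
# The square-free adjacent forest Rayleigh inequality holds at EVERY adjacent pair of EVERY CONE (graph with a universal vertex)

Support file (`--supports stmt-CriticalPhenomena-4575`), FK sub-lane `prim-bschramm-fk-1` (gen 22) of the post-continuity programme;
builds on p205010 (kernel theorem, internal audit signed; external expert review pending).  No definitions, no named facts, no sorries;
standard axioms.

THE NODE (`AdjForestRayleighNoSqOn`; conjecture `AdjForestRayleighNoSqPos`): in the uniform ordered two-forest partition `(A, B)` of the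
pairs of a finite graph, `#{ov, oy ∈ A} ≤ #{ov ∈ A, oy ∈ B}` for any two pairs `ov, oy` at a common vertex.  A first INFINITE, dense,
non-minor-closed class on which the node is now completely settled: **CONES**.  If a finite simple graph with pair set `Eg` has a
universal vertex `a` (adjacent to every other vertex) and `Eg − a` joins `v` and `y`, then the node's inequality holds at `(o; v, y)`
for EVERY vertex `o` (**`adjForestNoSq_top_of_cone`**):
* `o = a`: `v ~ y` in `Eg − a` is `v ~ y` in the link of `a` — THE LOCALLY-CONNECTED THEOREM (`adjForestNoSq_top_of_linkReachable`);
* `o ≠ a`, `a ∉ {v, y}`: `v − a − y` is a path in the link of `o` (fan of length two);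
* `o ≠ a`, `a ∈ {v, y}`: `vy ∈ Eg` — THE TRIANGLE THEOREM.
Hence (**`adjForestNoSq_top_of_cone_connected`**): for a cone over a CONNECTED graph, the inequality holds at every `(o; v, y)` with
`ov, oy ∈ Eg`, `v ≠ y` — the square-free adjacent forest Rayleigh property of Semple–Welsh type for all cones `K₁ ∗ H`, `H` connected
(e.g. all wheels, all `K_n`, cones over grids), far outside the no-`K₄`-minor class where coefficientwise Rayleigh is known for all pairs.
(When `Eg − a` separates `v` from `y` and `o = a`, the node is the cut-vertex EQUALITY of `…ForestAdjacentCutVertex`; that bookkeeping is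
not repeated here.)
[cite: SempleWelsh2008, Conj. 1.1 (p. 2); Thm. 4.2 (p. 11)] [cite: Linusson2011, Prop. 2.6] [cite: Grimmett2006, §1.5 (p. 13)]
-/

noncomputable section

namespace Summit.CriticalPhenomena.PercolationContinuityZ3.Theorems
namespace FK

open Set Literature.Probability.LatticeModels Literature.Probability.Percolation
open scoped Classical symmDiff

variable {V : Type*} [Fintype V]

section Cone

variable {Eg : BondConfig V} {a o v y : V}

/-- **Cones**: if `a` is a universal vertex of the simple graph `Eg` (`s(a, w) ∈ Eg` for all `w ≠ a`), `ov, oy ∈ Eg`, `v ≠ y`, `o ∉ {v, y}`,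
and `v ~ y` in `Eg − a` (pairs avoiding `a`), then `#(Fo ∩ {ov, oy ∈ ω}, Fo) ≤ #(Fo ∩ {ov ∈ ω}, Fo ∩ {oy ∈ ω})` on the top fibre
`(Eg, ∅)`. [cite: SempleWelsh2008, Conj. 1.1 (p. 2)] [cite: Linusson2011, Prop. 2.6] -/
theorem adjForestNoSq_top_of_cone (huniv : ∀ w, w ≠ a → s(a, w) ∈ Eg) (he : s(o, v) ∈ Eg) (hf : s(o, y) ∈ Eg) (hvy : v ≠ y)
    (hov : o ≠ v) (hoy : o ≠ y) (hconn : (openGraph {g ∈ Eg | a ∉ g}).Reachable v y) :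
    fibreCount Eg ∅ (forestEv V ∩ {ω | s(o, v) ∈ ω ∧ s(o, y) ∈ ω}) (forestEv V) ≤
      fibreCount Eg ∅ (forestEv V ∩ {ω | s(o, v) ∈ ω}) (forestEv V ∩ {ω | s(o, y) ∈ ω}) := by
  by_cases hoa : o = a
  · -- the apex: `Eg − a` is the link of `a`
    subst hoa
    refine adjForestNoSq_top_of_linkReachable Eg hvy (hconn.mono (openGraph_mono fun g hg => ⟨hg.1, fun w hw => ?_⟩))
    have hwa : w ≠ o := fun h => hg.2 (h ▸ hw)
    exact ⟨hwa, huniv w hwa⟩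
  · by_cases hva : v = a
    · -- `v = a` is universal: `vy ∈ Eg`, the triangle theorem
      subst hva
      exact adjForestNoSq_top_of_triangle Eg hvy (huniv y hvy.symm)
    · by_cases hya : y = a
      · subst hya
        have hg : s(v, y) ∈ Eg := by rw [Sym2.eq_swap]; exact huniv v hva
        exact adjForestNoSq_top_of_triangle Eg hvy hg
      · -- `v − a − y` inside the link of `o`
        have hav : s(a, v) ∈ Eg := huniv v hva
        have hay : s(a, y) ∈ Eg := huniv y hya
        have hao : s(o, a) ∈ Eg := by rw [Sym2.eq_swap]; exact huniv o hoa
        have hlink : ∀ {p q : V}, s(p, q) ∈ Eg → p ≠ o → q ≠ o → s(o, p) ∈ Eg → s(o, q) ∈ Eg → p ≠ q →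
            (openGraph {g ∈ Eg | ∀ w ∈ g, w ≠ o ∧ s(o, w) ∈ Eg}).Reachable p q := fun hpq hp hq hop hoq hne =>
          reach_of_mem (ω := {g ∈ Eg | ∀ w ∈ g, w ≠ o ∧ s(o, w) ∈ Eg}) ⟨hpq, fun w hw => by
            rcases Sym2.mem_iff.1 hw with rfl | rfl
            · exact ⟨hp, hop⟩
            · exact ⟨hq, hoq⟩⟩ hne
        refine adjForestNoSq_top_of_linkReachable Eg hvy ?_
        exact (hlink (by rw [Sym2.eq_swap]; exact hav) hov.symm (Ne.symm hoa) he hao hva).trans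
          (hlink hay (Ne.symm hoa) hoy.symm hao hf (Ne.symm hya))

/-- **Cones over connected graphs satisfy the square-free adjacent forest Rayleigh inequality at every adjacent pair**: if `a` is
universal in `Eg` and `Eg − a` is connected on `V ∖ {a}`, then for all `o` and `v ≠ y` with `ov, oy ∈ Eg`:
`#(Fo ∩ {ov, oy ∈ ω}, Fo) ≤ #(Fo ∩ {ov ∈ ω}, Fo ∩ {oy ∈ ω})` on `(Eg, ∅)` — negative correlation of every two adjacent pairs in the uniform
ordered two-forest partition of a cone `K₁ ∗ H`, `H` connected. [cite: SempleWelsh2008, Conj. 1.1 (p. 2); Thm. 4.2 (p. 11)]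
[cite: Linusson2011, Prop. 2.6] -/
theorem adjForestNoSq_top_of_cone_connected (huniv : ∀ w, w ≠ a → s(a, w) ∈ Eg)
    (hH : ∀ p q, p ≠ a → q ≠ a → (openGraph {g ∈ Eg | a ∉ g}).Reachable p q) (he : s(o, v) ∈ Eg) (hf : s(o, y) ∈ Eg)
    (hvy : v ≠ y) :
    fibreCount Eg ∅ (forestEv V ∩ {ω | s(o, v) ∈ ω ∧ s(o, y) ∈ ω}) (forestEv V) ≤
      fibreCount Eg ∅ (forestEv V ∩ {ω | s(o, v) ∈ ω}) (forestEv V ∩ {ω | s(o, y) ∈ ω}) := by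
  -- loops: the left side vanishes
  by_cases hov : o = v
  · subst hov
    rw [fibreCount_eq_zero_of_forall _ _ _ _ fun ω _ hA _ =>
      not_mem_of_isForestCfg_of_isDiag hA.1 (Sym2.mk_isDiag_iff.2 rfl) hA.2.1]
    exact Nat.zero_le _
  by_cases hoy : o = y
  · subst hoy
    rw [fibreCount_eq_zero_of_forall _ _ _ _ fun ω _ hA _ =>
      not_mem_of_isForestCfg_of_isDiag hA.1 (Sym2.mk_isDiag_iff.2 rfl) hA.2.2]
    exact Nat.zero_le _
  by_cases hoa : o = a
  · -- at the apex `v, y ≠ a`, so they are joined in `Eg − a`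
    exact adjForestNoSq_top_of_cone huniv he hf hvy hov hoy (hH v y (fun h => hov (hoa.trans h.symm)) fun h => hoy (hoa.trans h.symm))
  · by_cases hva : v = a
    · subst hva
      exact adjForestNoSq_top_of_triangle Eg hvy (huniv y hvy.symm)
    · by_cases hya : y = a
      · subst hya
        have hg : s(v, y) ∈ Eg := by rw [Sym2.eq_swap]; exact huniv v hva
        exact adjForestNoSq_top_of_triangle Eg hvy hg
      · exact adjForestNoSq_top_of_cone huniv he hf hvy hov hoy (hH v y hva hya)

end Cone

end FK
end Summit.CriticalPhenomena.PercolationContinuityZ3.Theorems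

end
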